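import Literature.NumberTheory.EllipticCurves.CanonicalPAdicHeightParallelogramProofs

/-!
# BirchSwinnertonDyer / PAdicOrderV2 — crux `PAdicOrderThesisR2` (stmt-0487), line `wieferich-jet`,
# stub `stub_pointShape`: the valuation shape of an `E₁`-point on a globally minimal equation

Registered stub of the lead skeleton (`Cruxes/PAdicOrderThesisR2/Lines/wieferich_jet.lean`):
for a globally minimal (hence `ℤ`-integral) Weierstrass equation `W/ℚ`, a prime `p` and a
rational point `(x, y)` with `‖x‖_p > 1`, writing `t = -x/y ∈ ℚ_p`, one has

* `y ≠ 0`,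
* `‖x‖_p · ‖t‖_p² = 1` (AEC VII.2.2: `3 v(x) = 2 v(y)`),
* `‖x t² - 1 + a₁ t‖_p ≤ ‖t‖_p²`.

Proof.  The first two conjuncts are the valuation shape `v_zw_of_one_lt` of
`ReductionHomomorphism.lean` (for the local model `W.localModel p` over `ℤ_(p)`, whose base change
to `ℚ` is `W` by `rfl`), transported to `p`-adic norms through `ratAdicValuation_apply`.  For the
third, the chart equation `w = z³ + a₁zw + a₂z²w + a₃w² + a₄zw² + a₆w³` (`z = -x/y`, `w = -1/y`,
AEC IV.1, `equation_zw`) divided by `w` reads `1 = x z² + a₁ z + a₂ z² + a₃ w + a₄ z w + a₆ w²`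
(as `z = x w`), so `x z² - 1 + a₁ z = -(a₂ z² + a₃ w + a₄ z w + a₆ w²)`, each term of which has
valuation `≤ v(z)²` because `v(aᵢ) ≤ 1`, `v(w) = v(z)³ < v(z)² ≤ 1`.  Everything used is proved
in the tree; the stub is unconditional.
-/

-- single-conjunct summit: `Summit.BirchSwinnertonDyer.BirchSwinnertonDyer.…` repeats the name by design
set_option linter.dupNamespace false

namespace Summit.BirchSwinnertonDyer.BirchSwinnertonDyer.Cruxes.PAdicOrderThesisR2.WieferichJet

open Literature.NumberTheory.EllipticCurves

open scoped NNReal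

/-- **The chart identity behind the point shape.** Over any field, if `(x, y)` satisfies the
Weierstrass equation and `y ≠ 0`, then with `z = -x/y`, `w = -1/y`,
`x z² - 1 + a₁ z = -(a₂ z² + a₃ w + a₄ z w + a₆ w²)` (the chart equation of Silverman,
*AEC* IV.1 divided by `w`, using `z = x w`). [cite: SilvermanAEC2009, IV.1 (PDF p. 109)] -/
theorem X_mul_z_sq_sub_one_add {F : Type*} [Field F] (W : WeierstrassCurve.Affine F) {x y : F}
    (h : W.Equation x y) (hy : y ≠ 0) :
    x * (-x / y) ^ 2 - 1 + W.a₁ * (-x / y) =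
      -(W.a₂ * (-x / y) ^ 2 + W.a₃ * (-1 / y) + W.a₄ * (-x / y) * (-1 / y)
        + W.a₆ * (-1 / y) ^ 2) := by
  have hzw := WeierstrassCurve.Affine.equation_zw W h hy
  have hw0 : (-1 / y : F) ≠ 0 := div_ne_zero (by norm_num) hy
  have hzx : (-x / y : F) = x * (-1 / y) := by ring
  refine mul_left_cancel₀ hw0 ?_
  linear_combination -hzw - (-x / y) ^ 2 * hzx

/-- **Stub `stub_pointShape` of line `wieferich-jet` (crux `PAdicOrderThesisR2`, stmt-0487): the
valuation shape of an `E₁`-point on a globally minimal equation.** For `W/ℚ` globally minimal,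
`p` prime and a rational point `(x, y)` with `‖x‖_p > 1`: `y ≠ 0`, `‖x‖_p ‖t‖_p² = 1` and
`‖x t² - 1 + a₁ t‖_p ≤ ‖t‖_p²` for `t = -x/y` (Silverman, *AEC* VII.2.2 with IV.1: `3v(x) = 2v(y)`
and the chart equation divided by `w`, the coefficients being `p`-integral).
[cite: SilvermanAEC2009, VII.2 Prop. 2.2 (PDF p. 170)] -/
theorem stub_pointShape :
    ∀ (W : WeierstrassCurve ℚ) [W.IsGloballyMinimal] (p : ℕ) [Fact p.Prime] {x y : ℚ},
      W.toAffine.Nonsingular x y → 1 < ‖(x : ℚ_[p])‖ →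
        (y : ℚ_[p]) ≠ 0 ∧ ‖(x : ℚ_[p])‖ * ‖-(x : ℚ_[p]) / y‖ ^ 2 = 1 ∧
          ‖(x : ℚ_[p]) * (-(x : ℚ_[p]) / y) ^ 2 - 1 + (W.a₁ : ℚ_[p]) * (-(x : ℚ_[p]) / y)‖
            ≤ ‖-(x : ℚ_[p]) / y‖ ^ 2 := by
  intro W _ p _ x y h hx
  have hv := integers_localIntegers p
  have h1 : ((W.localModel p).baseChange ℚ).toAffine.Equation x y := h.1
  have hx' : 1 < ratAdicValuation p x := by
    rw [ratAdicValuation_apply, ← NNReal.coe_lt_coe, NNReal.coe_one, coe_nnnorm]; exact hx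
  obtain ⟨hy, hz, hwz, -, hF⟩ := Literature.NumberTheory.EllipticCurves.v_zw_of_one_lt hv h1 hx'
  have hy' : (y : ℚ_[p]) ≠ 0 := by exact_mod_cast hy
  -- `p`-integrality of the coefficients of the (globally minimal, hence `ℤ`-integral) equation
  have ha₂ : ratAdicValuation p W.a₂ ≤ 1 := hv.map_le_one (W.localModel p).a₂
  have ha₃ : ratAdicValuation p W.a₃ ≤ 1 := hv.map_le_one (W.localModel p).a₃
  have ha₄ : ratAdicValuation p W.a₄ ≤ 1 := hv.map_le_one (W.localModel p).a₄
  have ha₆ : ratAdicValuation p W.a₆ ≤ 1 := hv.map_le_one (W.localModel p).a₆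
  refine ⟨hy', ?_, ?_⟩
  · -- `‖x‖ ‖t‖² = 1`
    have hF' : ((ratAdicValuation p (-x / y) : ℝ≥0) : ℝ) ^ 2 * (ratAdicValuation p x : ℝ) = 1 := by
      exact_mod_cast hF
    rw [ratAdicValuation_apply, ratAdicValuation_apply, coe_nnnorm, coe_nnnorm, Rat.cast_div,
      Rat.cast_neg] at hF'
    rw [mul_comm]; exact hF'
  · -- `‖x t² - 1 + a₁ t‖ ≤ ‖t‖²`
    set v := ratAdicValuation p
    have hz1 : v (-x / y) ≤ 1 := hz.le
    have hw1 : v (-1 / y) ≤ 1 := (hwz.trans_le ((sq_le_one_iff₀ zero_le).mpr hz1)).le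
    have hwz' : v (-1 / y) ≤ v (-x / y) ^ 2 := hwz.le
    have hkey := X_mul_z_sq_sub_one_add W.toAffine h.1 hy
    have hbound : v (x * (-x / y) ^ 2 - 1 + W.a₁ * (-x / y)) ≤ v (-x / y) ^ 2 := by
      rw [hkey, Valuation.map_neg]
      refine Valuation.map_add_le _ (Valuation.map_add_le _ (Valuation.map_add_le _ ?_ ?_) ?_) ?_
      · rw [map_mul, map_pow]
        exact mul_le_of_le_one_left zero_le ha₂
      · rw [map_mul]
        exact (mul_le_of_le_one_left zero_le ha₃).trans hwz'
      · rw [map_mul, map_mul]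
        calc v W.a₄ * v (-x / y) * v (-1 / y) ≤ v (-1 / y) :=
              mul_le_of_le_one_left zero_le (mul_le_one' ha₄ hz1)
          _ ≤ v (-x / y) ^ 2 := hwz'
      · rw [map_mul, map_pow, sq (v (-1 / y)), ← mul_assoc]
        calc v W.a₆ * v (-1 / y) * v (-1 / y) ≤ v (-1 / y) :=
              mul_le_of_le_one_left zero_le (mul_le_one' ha₆ hw1)
          _ ≤ v (-x / y) ^ 2 := hwz'
    have hreal : ‖((x * (-x / y) ^ 2 - 1 + W.a₁ * (-x / y) : ℚ) : ℚ_[p])‖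
        ≤ ‖((-x / y : ℚ) : ℚ_[p])‖ ^ 2 := by
      rw [← coe_nnnorm, ← coe_nnnorm, ← ratAdicValuation_apply, ← ratAdicValuation_apply]
      exact_mod_cast hbound
    push_cast at hreal
    exact hreal

end Summit.BirchSwinnertonDyer.BirchSwinnertonDyer.Cruxes.PAdicOrderThesisR2.WieferichJet
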